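import Mathlib
import Summits.AtomisticToContinuum.Crystallization.Theses.PhononSlackCertificates

/-!
# Sketch — crux `NearFarGlueR` (stmt-AtomisticToContinuum-14970), idea `young-levy-quiet-collar`

Two checkable statements of the line.

1. `young_levy` (PROVED, pure bookkeeping): the glue closes by a convex combination + Young's
   inequality as soon as the near side exports its interface term as an EXPLICIT first-order
   functional `Σ ⟪u_i, G_i⟫` (reference prestress forces `G_i` of the truncated chart, chart
   displacements `u_i`) plus zeroth-order adhesion defects `A_i`, and the gross side pays, per cut
   site, the Young allowance `‖G_i‖² / (4θκ)` out of its zeroth-order surplus.  This is the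
   statement that replaces "g > C_tail + C_interface" (flat constants) in the crux docstring.

2. `InterfaceGap` / `nearFarGlueR_of_interfaceGap` (statement only): the EXACT residual of the
   crux as typed — with the flat `∃ C` constants of `FarFieldGapR` / `NearFieldConvexity`, the
   implication is equivalent (up to packing counts) to a global gap charging only bad particles
   within `R'` of a good one.
-/

namespace Summit.AtomisticToContinuum.Crystallization.Cruxes.NearFarGlueR.YoungLevyQuietCollar

open scoped BigOperators InnerProductSpace
open Finset

/-- **Abstract Young levy (bookkeeping core of the line).**  Index set `ι` = particles; `near` =
chartable region 𝒩 (its complement is the gross set D); `bad` = 1/20-bad particles; `prox ⊆ bad ∩ 𝒩`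
= bad-by-proximity (a gross particle or a chart hole within two shells); `ex i = e_i − e*` site
excess; near side: `Σ_{𝒩} ex ≥ Σ_{𝒩} (q + ⟪u, G⟫ + A)` with `q_i ≥ κ‖u_i‖²` the coercive part,
`G_i` the reference force imbalance (nonzero only at cut sites), `A_i` the adhesion defect; the
displacement-bad particles are paid by `(1 − θ) Σ q`; the gross side pays `g₀` for its own and the
proximal bad particles, returns the adhesion defects and covers the Young allowance
`‖G_i‖²/(4θκ)`.  Conclusion: the coercive two-shell inequality `g₀ · #bad ≤ Σ_i (e_i − e*)`. -/
theorem young_levy {ι : Type*} [Fintype ι] [DecidableEq ι]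
    (near bad prox : Finset ι) (ex q A : ι → ℝ) (u G : ι → EuclideanSpace ℝ (Fin 3))
    (κ θ g₀ : ℝ) (hκ : 0 < κ) (hθ : 0 < θ) (hg : 0 ≤ g₀)
    (hprox : prox ⊆ bad ∩ near)
    (hN : ∑ i ∈ near, (q i + ⟪u i, G i⟫_ℝ + A i) ≤ ∑ i ∈ near, ex i)
    (hq : ∀ i ∈ near, κ * ‖u i‖ ^ 2 ≤ q i)
    (hB : g₀ * ((((bad ∩ near) \ prox).card : ℕ) : ℝ) ≤ (1 - θ) * ∑ i ∈ near, q i)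
    (hD : g₀ * (((bad \ near).card : ℕ) : ℝ) + g₀ * ((prox.card : ℕ) : ℝ)
            + ∑ i ∈ near, ‖G i‖ ^ 2 / (4 * θ * κ)
          ≤ ∑ j ∈ nearᶜ, ex j + ∑ i ∈ near, A i) :
    g₀ * ((bad.card : ℕ) : ℝ) ≤ ∑ i, ex i := by
  have hθ0 : θ ≠ 0 := hθ.ne'
  have hκ0 : κ ≠ 0 := hκ.ne'
  -- Young at every near site: ⟪u, G⟫ ≥ −θ q − ‖G‖²/(4θκ)
  have hY : ∀ i ∈ near, -(θ * q i) - ‖G i‖ ^ 2 / (4 * θ * κ) ≤ ⟪u i, G i⟫_ℝ := by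
    intro i hi
    have h1 : |⟪u i, G i⟫_ℝ| ≤ ‖u i‖ * ‖G i‖ := abs_real_inner_le_norm _ _
    have h2 : ‖u i‖ * ‖G i‖ ≤ θ * κ * ‖u i‖ ^ 2 + ‖G i‖ ^ 2 / (4 * θ * κ) := by
      rw [← sub_nonneg]
      have hpos : 0 < 4 * θ * κ := by positivity
      have key : θ * κ * ‖u i‖ ^ 2 + ‖G i‖ ^ 2 / (4 * θ * κ) - ‖u i‖ * ‖G i‖
          = (2 * θ * κ * ‖u i‖ - ‖G i‖) ^ 2 / (4 * θ * κ) := by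
        field_simp
        ring
      rw [key]
      positivity
    have h3 : θ * κ * ‖u i‖ ^ 2 ≤ θ * q i := by
      have := hq i hi
      have : θ * (κ * ‖u i‖ ^ 2) ≤ θ * q i := mul_le_mul_of_nonneg_left this hθ.le
      linarith
    have h4 := (abs_le.mp (h1.trans h2)).1
    linarith
  -- near side after Young: (1 − θ) Σ q − Σ ‖G‖²/(4θκ) + Σ A ≤ Σ_{𝒩} ex
  have hnear : (1 - θ) * ∑ i ∈ near, q i - ∑ i ∈ near, ‖G i‖ ^ 2 / (4 * θ * κ)
      + ∑ i ∈ near, A i ≤ ∑ i ∈ near, ex i := by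
    have hle : ∑ i ∈ near, ((1 - θ) * q i - ‖G i‖ ^ 2 / (4 * θ * κ) + A i)
        ≤ ∑ i ∈ near, (q i + ⟪u i, G i⟫_ℝ + A i) := by
      apply Finset.sum_le_sum
      intro i hi
      have := hY i hi
      linarith
    have e1 : ∑ i ∈ near, ((1 - θ) * q i - ‖G i‖ ^ 2 / (4 * θ * κ) + A i)
        = (1 - θ) * ∑ i ∈ near, q i - ∑ i ∈ near, ‖G i‖ ^ 2 / (4 * θ * κ)
          + ∑ i ∈ near, A i := by
      rw [Finset.sum_add_distrib, Finset.sum_sub_distrib, Finset.mul_sum]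
    linarith
  -- total = near + complement
  have htot : ∑ i ∈ near, ex i + ∑ i ∈ nearᶜ, ex i = ∑ i, ex i :=
    Finset.sum_add_sum_compl near ex
  -- counting: #bad ≤ #(bad ∖ 𝒩) + #((bad ∩ 𝒩) ∖ prox) + #prox
  have hc : bad.card ≤ (bad \ near).card + ((bad ∩ near) \ prox).card + prox.card := by
    calc bad.card = ((bad \ near) ∪ (bad ∩ near)).card := by rw [Finset.sdiff_union_inter]
      _ ≤ (bad \ near).card + (bad ∩ near).card := Finset.card_union_le _ _
      _ = (bad \ near).card + (((bad ∩ near) \ prox) ∪ prox).card := by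
          rw [Finset.sdiff_union_of_subset hprox]
      _ ≤ (bad \ near).card + (((bad ∩ near) \ prox).card + prox.card) := by
          gcongr
          exact Finset.card_union_le _ _
      _ = (bad \ near).card + ((bad ∩ near) \ prox).card + prox.card := by ring
  have hcR : ((bad.card : ℕ) : ℝ)
      ≤ ((bad \ near).card : ℝ) + (((bad ∩ near) \ prox).card : ℝ) + (prox.card : ℝ) := by
    exact_mod_cast hc
  have hgc := mul_le_mul_of_nonneg_left hcR hg
  nlinarith [hgc, hB, hD, hnear, htot]

open Literature.MathematicalPhysics.StatisticalMechanics Literature.Geometry.DiscreteGeometry in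
/-- **The exact residual of the crux as typed.**  A global coercive gap that charges only the bad
particles lying within `R'` of a GOOD particle (the interface population that both flat slacks of
`FarFieldGapR` (radius `R(δ)`) and `NearFieldConvexity` (radius `4`) are spent on). -/
def InterfaceGap : Prop :=
  ∀ δ : ℝ, 0 < δ → ∀ R' : ℝ, ∃ g₂ : ℝ, 0 < g₂ ∧
    ∀ (N : ℕ) (x : Fin N → EuclideanSpace ℝ (Fin 3)),
      (∀ i j : Fin N, i ≠ j → δ ≤ dist (x i) (x j)) →
      (N : ℝ) * (⨅ Q : PeriodicConfiguration 3, Q.energyPerParticle lennardJones)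
        + g₂ * (Nat.card {i : Fin N // ¬ IsTwoShellGood (1 / 20) (47 / 50) 1 x i ∧
            ∃ j : Fin N, IsTwoShellGood (1 / 20) (47 / 50) 1 x j ∧ dist (x j) (x i) ≤ R'} : ℝ)
        ≤ interactionEnergy lennardJones x

/-- **Residual equivalence (one direction, statement only; the line does NOT take this road).**
With `U := all bad particles` in `FarFieldGapR` and `Ω := all good particles` in
`NearFieldConvexity` (its `c`-term dropped), every flat slack is charged to a bad particle within
`max R 4` of a good one (packing count `card_le_of_separated_of_dist_le`), so `InterfaceGap` closes
the typed glue by the convex combination `λ·(FF + NF) + (1 − λ)·InterfaceGap`.  Conversely the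
typed glue gives nothing more on configurations whose bad set is `R`-porous (refuter evidence
`Evidence14970.lean`): InterfaceGap IS the crux's content, and near an isolated good particle in an
amorphous matrix it is far-field (AllBadGap-type) content — which is why the line re-cuts both
tiers instead (see the idea card). -/
theorem nearFarGlueR_of_interfaceGap :
    InterfaceGap → Summit.AtomisticToContinuum.Crystallization.Theses.PhononSlackCertificates.NearFarGlueR := by
  sorry

end Summit.AtomisticToContinuum.Crystallization.Cruxes.NearFarGlueR.YoungLevyQuietCollar
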